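import Literature.NumberTheory.Sieve.FriableCellFactorisation
import Mathlib.NumberTheory.Harmonic.Bounds
import Mathlib.Analysis.SpecialFunctions.Exp
import HarnessLib

/-!
# Cell factorisation of friable squarefree integers, III: counting lemmas

Topic `Literature/NumberTheory/Sieve`; sequel of `FriableCellFactorisation.lean`.  Everything
PROVED, elementary:

* `card_filter_cell_eq_le` — at most `q (e^{1/T} − 1)` integers `q' > q` share the cell of `q`;
* `sum_Ico_one_div_le` — `∑_{1 ≤ q < Y} 1/q ≤ 1 + log Y`;
* `sum_pairs_cell_le` — `∑_{q < q' < Y, same cell} 1/(q q') ≤ (e^{1/T} − 1)(1 + log Y)`;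
* `card_twoInCell_le` — the `Y`-friable `d ≤ Dn` with two distinct prime factors in one cell
  number `≤ Dn (e^{1/T} − 1)(1 + log Y)` (the exceptional set of the class partition of
  `FriableCellPartition.lean`);
* `exp_le_of_cell_eq`, `mul_le_of_le_mul_exp`, `mul_exp_lt_mul` — location of `n m` against a
  sharp cut-off `D` when `n` lies in one cell (`e^{j/T} ≤ n < e^{(j+1)/T}`): `m ≤ D e^{−(j+1)/T}`
  forces `n m ≤ D`, and `m > D e^{−(j+1)/T}` forces `n m > D e^{−1/T}`;
* `card_filter_lt_le` — the integers of `(R, Dn]` number `≤ max 0 (Dn − R + 1)`.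

[cite: Greaves2001, Ch. 6, §6.1] for the cell device; the statements are folklore.
-/

open Finset Real

noncomputable section

/-! ## Counting lemmas for the cell factorisation: exceptional `d`, boundary location -/

namespace Literature.NumberTheory.Sieve.FriableCell

/-- The integers `q' > q` in the cell of `q` number at most `q (e^{1/T} − 1)`. [folklore] -/
theorem card_filter_cell_eq_le {T : ℝ} (hT : 0 < T) {q : ℕ} (hq : 1 ≤ q) (s : Finset ℕ) :
    ((s.filter (fun q' => q < q' ∧ cell T q' = cell T q)).card : ℝ) ≤ q * (Real.exp (1 / T) - 1) := by
  set R : ℝ := q * Real.exp (1 / T) with hR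
  have hsub : s.filter (fun q' => q < q' ∧ cell T q' = cell T q) ⊆ Finset.Ioo q ⌈R⌉₊ := by
    intro q' hq'
    rw [Finset.mem_filter] at hq'
    rw [Finset.mem_Ioo]
    refine ⟨hq'.2.1, Nat.lt_ceil.mpr ?_⟩
    exact lt_mul_exp_of_cell_eq hT hq (le_trans hq hq'.2.1.le) hq'.2.2.symm
  have hcard := Finset.card_le_card hsub
  rw [Nat.card_Ioo] at hcard
  have hR0 : 0 ≤ R := by positivity
  have hceil : (⌈R⌉₊ : ℝ) < R + 1 := Nat.ceil_lt_add_one hR0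
  have h1 : ((⌈R⌉₊ - q - 1 : ℕ) : ℝ) ≤ R - q := by
    rcases le_or_gt (q + 1) ⌈R⌉₊ with h | h
    · have : ((⌈R⌉₊ - q - 1 : ℕ) : ℝ) = (⌈R⌉₊ : ℝ) - q - 1 := by
        rw [Nat.sub_sub, Nat.cast_sub h]; push_cast; ring
      rw [this]; linarith
    · have : ⌈R⌉₊ - q - 1 = 0 := by omega
      rw [this, Nat.cast_zero]
      have : (q : ℝ) ≤ R := by
        rw [hR]
        exact le_mul_of_one_le_right (by positivity) (Real.one_le_exp (by positivity))
      linarith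
  calc ((s.filter (fun q' => q < q' ∧ cell T q' = cell T q)).card : ℝ)
      ≤ ((⌈R⌉₊ - q - 1 : ℕ) : ℝ) := by exact_mod_cast hcard
    _ ≤ R - q := h1
    _ = q * (Real.exp (1 / T) - 1) := by rw [hR]; ring

/-- `∑_{1 ≤ q < Y} 1/q ≤ 1 + log Y`. [folklore] -/
theorem sum_Ico_one_div_le (Y : ℕ) : ∑ q ∈ Finset.Ico 1 Y, (1 : ℝ) / q ≤ 1 + Real.log Y := by
  have h := harmonic_le_one_add_log Y
  rw [harmonic_eq_sum_Icc] at h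
  push_cast at h
  have hsub : Finset.Ico 1 Y ⊆ Finset.Icc 1 Y := fun q hq => by
    rw [Finset.mem_Ico] at hq; rw [Finset.mem_Icc]; omega
  calc ∑ q ∈ Finset.Ico 1 Y, (1 : ℝ) / q ≤ ∑ q ∈ Finset.Icc 1 Y, (1 : ℝ) / q :=
        Finset.sum_le_sum_of_subset_of_nonneg hsub fun _ _ _ => by positivity
    _ = ∑ q ∈ Finset.Icc 1 Y, ((q : ℝ))⁻¹ := Finset.sum_congr rfl fun _ _ => one_div _
    _ ≤ 1 + Real.log Y := h

/-- **Pairs in a common cell are sparse**: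
`∑_{1 ≤ q < Y} ∑_{q < q' < Y, cell q' = cell q} 1/(q q') ≤ (e^{1/T} − 1)(1 + log Y)`. [folklore] -/
theorem sum_pairs_cell_le {T : ℝ} (hT : 0 < T) (Y : ℕ) :
    ∑ q ∈ Finset.Ico 1 Y, ∑ q' ∈ (Finset.Ico 1 Y).filter (fun q' => q < q' ∧ cell T q' = cell T q),
        (1 : ℝ) / (q * q') ≤ (Real.exp (1 / T) - 1) * (1 + Real.log Y) := by
  have hE : 0 ≤ Real.exp (1 / T) - 1 := by
    have := Real.one_le_exp (show (0:ℝ) ≤ 1 / T by positivity); linarith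
  have hinner : ∀ q ∈ Finset.Ico 1 Y,
      ∑ q' ∈ (Finset.Ico 1 Y).filter (fun q' => q < q' ∧ cell T q' = cell T q), (1 : ℝ) / (q * q') ≤
        (Real.exp (1 / T) - 1) * (1 / q) := by
    intro q hq
    have hq1 : 1 ≤ q := (Finset.mem_Ico.mp hq).1
    have hq0 : (0 : ℝ) < q := by exact_mod_cast hq1
    have hterm : ∀ q' ∈ (Finset.Ico 1 Y).filter (fun q' => q < q' ∧ cell T q' = cell T q),
        (1 : ℝ) / (q * q') ≤ 1 / (q * q) := by
      intro q' hq'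
      have hlt := (Finset.mem_filter.mp hq').2.1
      have : (q : ℝ) ≤ q' := by exact_mod_cast hlt.le
      exact one_div_le_one_div_of_le (by positivity) (by nlinarith)
    calc ∑ q' ∈ (Finset.Ico 1 Y).filter (fun q' => q < q' ∧ cell T q' = cell T q), (1 : ℝ) / (q * q')
        ≤ ∑ q' ∈ (Finset.Ico 1 Y).filter (fun q' => q < q' ∧ cell T q' = cell T q), (1 : ℝ) / (q * q) :=
          Finset.sum_le_sum hterm
      _ = ((Finset.Ico 1 Y).filter (fun q' => q < q' ∧ cell T q' = cell T q)).card * (1 / (q * q)) := by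
          rw [Finset.sum_const, nsmul_eq_mul]
      _ ≤ q * (Real.exp (1 / T) - 1) * (1 / (q * q)) :=
          mul_le_mul_of_nonneg_right (card_filter_cell_eq_le hT hq1 _) (by positivity)
      _ = (Real.exp (1 / T) - 1) * (1 / q) := by field_simp
  calc ∑ q ∈ Finset.Ico 1 Y, ∑ q' ∈ (Finset.Ico 1 Y).filter (fun q' => q < q' ∧ cell T q' = cell T q),
        (1 : ℝ) / (q * q')
      ≤ ∑ q ∈ Finset.Ico 1 Y, (Real.exp (1 / T) - 1) * (1 / q) := Finset.sum_le_sum hinner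
    _ = (Real.exp (1 / T) - 1) * ∑ q ∈ Finset.Ico 1 Y, (1 : ℝ) / q := by rw [Finset.mul_sum]
    _ ≤ (Real.exp (1 / T) - 1) * (1 + Real.log Y) :=
        mul_le_mul_of_nonneg_left (sum_Ico_one_div_le Y) hE

/-- **The `d` with two distinct prime factors in one cell are few**: among the `Y`-friable
`d ≤ Dn` their number is `≤ Dn (e^{1/T} − 1)(1 + log Y)`. [folklore] -/
theorem card_twoInCell_le {T : ℝ} (hT : 0 < T) (Dn Y : ℕ) :
    (((Nat.smoothNumbersUpTo Dn Y).filter (fun d => ∃ q ∈ d.primeFactors, ∃ q' ∈ d.primeFactors,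
        q ≠ q' ∧ cell T q = cell T q')).card : ℝ) ≤
      Dn * (Real.exp (1 / T) - 1) * (1 + Real.log Y) := by
  classical
  set Bad := (Nat.smoothNumbersUpTo Dn Y).filter (fun d => ∃ q ∈ d.primeFactors,
    ∃ q' ∈ d.primeFactors, q ≠ q' ∧ cell T q = cell T q') with hBad
  set Pairs := ((Finset.Ico 1 Y) ×ˢ (Finset.Ico 1 Y)).filter
    (fun qq : ℕ × ℕ => qq.1 < qq.2 ∧ cell T qq.2 = cell T qq.1) with hPairs
  set Mult : ℕ × ℕ → Finset ℕ := fun qq => (Finset.Ioc 0 Dn).filter (fun d => qq.1 * qq.2 ∣ d)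
    with hMult
  -- `Bad ⊆ ⋃_{pairs} multiples`
  have hsub : Bad ⊆ Pairs.biUnion Mult := by
    intro d hd
    rw [hBad, Finset.mem_filter, Nat.mem_smoothNumbersUpTo] at hd
    obtain ⟨⟨hdD, hds⟩, q, hq, q', hq', hne, hc⟩ := hd
    have hd0 : d ≠ 0 := (Nat.mem_smoothNumbers.mp hds).1
    have hqp := Nat.prime_of_mem_primeFactors hq
    have hq'p := Nat.prime_of_mem_primeFactors hq'
    have hqd := Nat.dvd_of_mem_primeFactors hq
    have hq'd := Nat.dvd_of_mem_primeFactors hq'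
    have hqY : q < Y := (Nat.mem_smoothNumbers'.mp hds) q hqp hqd
    have hq'Y : q' < Y := (Nat.mem_smoothNumbers'.mp hds) q' hq'p hq'd
    have hcop : q.Coprime q' := (Nat.coprime_primes hqp hq'p).mpr hne
    rw [Finset.mem_biUnion]
    rcases lt_or_gt_of_ne hne with hlt | hgt
    · refine ⟨(q, q'), ?_, ?_⟩
      · rw [hPairs, Finset.mem_filter, Finset.mem_product, Finset.mem_Ico, Finset.mem_Ico]
        exact ⟨⟨⟨hqp.one_lt.le, hqY⟩, ⟨hq'p.one_lt.le, hq'Y⟩⟩, hlt, hc.symm⟩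
      · rw [hMult, Finset.mem_filter, Finset.mem_Ioc]
        exact ⟨⟨Nat.pos_of_ne_zero hd0, hdD⟩, hcop.mul_dvd_of_dvd_of_dvd hqd hq'd⟩
    · refine ⟨(q', q), ?_, ?_⟩
      · rw [hPairs, Finset.mem_filter, Finset.mem_product, Finset.mem_Ico, Finset.mem_Ico]
        exact ⟨⟨⟨hq'p.one_lt.le, hq'Y⟩, ⟨hqp.one_lt.le, hqY⟩⟩, hgt, hc⟩
      · rw [hMult, Finset.mem_filter, Finset.mem_Ioc]
        exact ⟨⟨Nat.pos_of_ne_zero hd0, hdD⟩, hcop.symm.mul_dvd_of_dvd_of_dvd hq'd hqd⟩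
  have hcard : (Bad.card : ℝ) ≤ ∑ qq ∈ Pairs, ((Mult qq).card : ℝ) := by
    have h := (Finset.card_le_card hsub).trans Finset.card_biUnion_le
    exact_mod_cast h
  have hMultcard : ∀ qq ∈ Pairs, ((Mult qq).card : ℝ) ≤ Dn * (1 / (qq.1 * qq.2)) := by
    intro qq hqq
    rw [hPairs, Finset.mem_filter, Finset.mem_product, Finset.mem_Ico, Finset.mem_Ico] at hqq
    have h1 : (0 : ℝ) < qq.1 := by exact_mod_cast hqq.1.1.1
    have h2 : (0 : ℝ) < qq.2 := by exact_mod_cast hqq.1.2.1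
    rw [hMult, Nat.Ioc_filter_dvd_card_eq_div]
    rw [mul_one_div]
    refine (Nat.cast_div_le).trans ?_
    push_cast
    exact le_rfl
  calc (Bad.card : ℝ) ≤ ∑ qq ∈ Pairs, ((Mult qq).card : ℝ) := hcard
    _ ≤ ∑ qq ∈ Pairs, (Dn : ℝ) * (1 / (qq.1 * qq.2)) := Finset.sum_le_sum hMultcard
    _ = Dn * ∑ qq ∈ Pairs, (1 : ℝ) / (qq.1 * qq.2) := by rw [Finset.mul_sum]
    _ = Dn * ∑ q ∈ Finset.Ico 1 Y, ∑ q' ∈ (Finset.Ico 1 Y).filter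
          (fun q' => q < q' ∧ cell T q' = cell T q), (1 : ℝ) / (q * q') := by
        congr 1
        rw [hPairs, Finset.sum_filter, Finset.sum_product]
        refine Finset.sum_congr rfl fun q _ => ?_
        rw [Finset.sum_filter]
    _ ≤ Dn * ((Real.exp (1 / T) - 1) * (1 + Real.log Y)) :=
        mul_le_mul_of_nonneg_left (sum_pairs_cell_le hT Y) (Nat.cast_nonneg _)
    _ = Dn * (Real.exp (1 / T) - 1) * (1 + Real.log Y) := by ring

/-! ### Boundary location: the sharp cut-off `n m ≤ D` inside one `n`-cell -/

/-- If `cell T n = j` then `e^{j/T} ≤ n < e^{(j+1)/T}`. [folklore] -/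
theorem exp_le_of_cell_eq {T : ℝ} (hT : 0 < T) {n j : ℕ} (hn : 1 ≤ n) (hj : cell T n = j) :
    Real.exp (j / T) ≤ n ∧ (n : ℝ) < Real.exp ((j + 1) / T) := by
  unfold cell at hj
  have hn0 : (0 : ℝ) < n := by exact_mod_cast hn
  have hl0 : 0 ≤ T * Real.log n := mul_nonneg hT.le (Real.log_nonneg (by exact_mod_cast hn))
  have h1 : (j : ℝ) ≤ T * Real.log n := by rw [← hj]; exact Nat.floor_le hl0
  have h2 : T * Real.log n < j + 1 := by rw [← hj]; exact Nat.lt_floor_add_one _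
  constructor
  · rw [← Real.exp_log hn0]
    refine Real.exp_le_exp.mpr ?_
    rw [div_le_iff₀ hT]; linarith
  · rw [← Real.exp_log hn0]
    refine Real.exp_lt_exp.mpr ?_
    rw [lt_div_iff₀ hT]; linarith

/-- **Full range**: for `cell T n = j` and `m ≤ D e^{−(j+1)/T}` one has `n m ≤ D`. [folklore] -/
theorem mul_le_of_le_mul_exp {T D : ℝ} (hT : 0 < T) {n m j : ℕ} (hn : 1 ≤ n)
    (hj : cell T n = j) (hm : (m : ℝ) ≤ D * Real.exp (-(((j : ℝ) + 1) / T))) : (n : ℝ) * m ≤ D := by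
  have h := (exp_le_of_cell_eq hT hn hj).2
  have hm0 : (0 : ℝ) ≤ m := Nat.cast_nonneg _
  calc (n : ℝ) * m ≤ Real.exp ((j + 1) / T) * (D * Real.exp (-(((j : ℝ) + 1) / T))) :=
        mul_le_mul h.le hm hm0 (Real.exp_pos _).le
    _ = D * (Real.exp ((j + 1) / T) * Real.exp (-(((j : ℝ) + 1) / T))) := by ring
    _ = D := by rw [← Real.exp_add, add_neg_cancel, Real.exp_zero, mul_one]

/-- **Boundary location**: for `cell T n = j` and `m > D e^{−(j+1)/T}` one has `n m > D e^{−1/T}`.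
[folklore] -/
theorem mul_exp_lt_mul {T D : ℝ} (hT : 0 < T) (hD : 0 ≤ D) {n m j : ℕ} (hn : 1 ≤ n)
    (hj : cell T n = j) (hm : D * Real.exp (-(((j : ℝ) + 1) / T)) < m) :
    D * Real.exp (-(1 / T)) < (n : ℝ) * m := by
  have h := (exp_le_of_cell_eq hT hn hj).1
  have he : Real.exp (-(1 / T)) = Real.exp (j / T) * Real.exp (-(((j : ℝ) + 1) / T)) := by
    rw [← Real.exp_add]; congr 1; field_simp; ring
  calc D * Real.exp (-(1 / T)) = Real.exp (j / T) * (D * Real.exp (-(((j : ℝ) + 1) / T))) := by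
        rw [he]; ring
    _ ≤ (n : ℝ) * (D * Real.exp (-(((j : ℝ) + 1) / T))) :=
        mul_le_mul_of_nonneg_right h (mul_nonneg hD (Real.exp_pos _).le)
    _ < (n : ℝ) * m := by
        have hn0 : (0 : ℝ) < n := by exact_mod_cast hn
        exact mul_lt_mul_of_pos_left hm hn0

/-- The integers `d ∈ (R, Dn]` (`R ≥ 0`) number at most `max 0 (Dn − R + 1)`. [folklore] -/
theorem card_filter_lt_le (Dn : ℕ) {R : ℝ} (hR : 0 ≤ R) (s : Finset ℕ) (hs : s ⊆ Finset.Icc 1 Dn) :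
    ((s.filter (fun d : ℕ => R < (d : ℝ))).card : ℝ) ≤ max 0 ((Dn : ℝ) - R + 1) := by
  have hsub : s.filter (fun d : ℕ => R < (d : ℝ)) ⊆ Finset.Ioc ⌊R⌋₊ Dn := by
    intro d hd
    rw [Finset.mem_filter] at hd
    rw [Finset.mem_Ioc]
    exact ⟨(Nat.floor_lt hR).mpr hd.2, (Finset.mem_Icc.mp (hs hd.1)).2⟩
  have hcard := Finset.card_le_card hsub
  rw [Nat.card_Ioc] at hcard
  rcases le_or_gt Dn ⌊R⌋₊ with h | h
  · have : Dn - ⌊R⌋₊ = 0 := Nat.sub_eq_zero_of_le h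
    rw [this] at hcard
    have : (s.filter (fun d : ℕ => R < (d : ℝ))).card = 0 := Nat.le_zero.mp hcard
    rw [this, Nat.cast_zero]; exact le_max_left _ _
  · refine le_trans ?_ (le_max_right _ _)
    have hfl : R < ⌊R⌋₊ + 1 := Nat.lt_floor_add_one R
    calc ((s.filter (fun d : ℕ => R < (d : ℝ))).card : ℝ) ≤ ((Dn - ⌊R⌋₊ : ℕ) : ℝ) := by exact_mod_cast hcard
      _ = (Dn : ℝ) - ⌊R⌋₊ := by rw [Nat.cast_sub h.le]
      _ ≤ (Dn : ℝ) - R + 1 := by linarith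

end Literature.NumberTheory.Sieve.FriableCell

end
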